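import Mathlib
import HarnessLib
import HarnessLib.Audit
import Summits.PneNP.Statement
import Literature.Computability.MetaComplexity.ClosureLocalUnionStability

/-!
Route: ClusUniversalCertificate

DORMANT since 2026-09-05T02:34:43Z (reconciler: no traction for 5 d (last activity item-evidence-added at 2026-08-31T01:45:16Z); parked, not closed — `ledger route dormant route-PneNP-ClusUniversalCertificate --off` to reactivate) — unstaffed, not closed; items shared with open routes are served there. `ledger route dormant <id> --off` reactivates.

# Route ClusUniversalCertificate — Res(⊕) closure-local union stability from the universal
affine-slice certificate

Rung F-N1 of the PneNP frontier ladder (cell pnp-ideate, seat p1; lens CLUS door; ALT-CLOSER pattern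
of D-0061 — the route closes the RUNG LEAF
`ClusExistsCapped` = `CLUSExistsCapped` of the cell companion file (closure-local union stability of
affine nice sets, capped, at one admissible
exponent point: the statement that TR26-007 pp. 15–16 actually consume in place of their refuted
Conjecture 4.2), NOT the summit `PneNP`).
It suffices to show X = X1 ∧ X2: X1 = `UniversalCertAll`, the universal block affine-slice
certificate (R★★_b): for every finite set Y of the
block space (𝔽₂^m)^n, Σ_{y∈Y} (n − codim_Y(y)) ≤ Σ_k 2^m·|Y ∩ {y_k = 0}|, codim_Y(y) = least
codimension of an affine flat through y inside Y;
X2 = `PairModelReduction`: X1 ⇒ PolyLoss (`CLUSPolylog`: closure-local deletions from rank-≤ w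
systems lose at most a (log₂N)^C′/N^(k−1−ε) fraction
of the nice union). PolyLoss ⇒ CLUSExists ⇒ CLUSExistsCapped is kernel-proved in the cell companion
(`clusExists_of_polylog`,
`clusExistsCapped_of_exists`; filed as the provable-now support item `PolylogGivesCapped`).
Lean: `(∀ n m : ℕ, ∀ Y : Finset (Fin n → Fin m → ZMod 2), ∑ y ∈ Y, ((n : ℤ) - ((sInf {c : ℕ | ∃ A :
AffineSubspace (ZMod 2) (Fin n → Fin m → ZMod 2), y ∈ A ∧ (∀ z ∈ A, z ∈ Y) ∧ n * m ≤ Module.finrank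
(ZMod 2) A.direction + c} : ℕ) : ℤ)) ≤ ∑ k : Fin n, (2 : ℤ) ^ m * ((Y.filter fun y => y k = 0).card
: ℤ)) ∧ ((∀ n m : ℕ, ∀ Y : Finset (Fin n → Fin m → ZMod 2), ∑ y ∈ Y, ((n : ℤ) - ((sInf {c : ℕ | ∃ A
: AffineSubspace (ZMod 2) (Fin n → Fin m → ZMod 2), y ∈ A ∧ (∀ z ∈ A, z ∈ Y) ∧ n * m ≤
Module.finrank (ZMod 2) A.direction + c} : ℕ) : ℤ)) ≤ ∑ k : Fin n, (2 : ℤ) ^ m * ((Y.filter fun y =>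
y k = 0).card : ℤ)) → ∃ q : ℝ, 2 < q ∧ ∃ k : ℕ, 4 ≤ k ∧ ∃ ε : ℝ, 0 < ε ∧ ε < 1 ∧ ∃ C C' : ℝ, ∃ N₀ :
ℕ, ∀ N : ℕ, N₀ ≤ N → ∃ f : (Fin k → Literature.Computability.MetaComplexity.CLUS.Hole
(Literature.Computability.MetaComplexity.CLUS.mOf k ε N)) →
Literature.Computability.MetaComplexity.CLUS.Hole (Literature.Computability.MetaComplexity.CLUS.mOf
k ε N), Literature.Computability.MetaComplexity.CLUS.PropI N
(Literature.Computability.MetaComplexity.CLUS.mOf k ε N) k f ∧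
Literature.Computability.MetaComplexity.CLUS.PropII
(Literature.Computability.MetaComplexity.CLUS.mOf k ε N) k f ∧ ∀ w : ℕ, (w : ℝ) ≤
Literature.Computability.MetaComplexity.CLUS.wOf q N →
Literature.Computability.MetaComplexity.CLUS.ClosureLocalUnionStableAt N
(Literature.Computability.MetaComplexity.CLUS.mOf k ε N) k f w
(Literature.Computability.MetaComplexity.CLUS.muOf k ε C N)
(Literature.Computability.MetaComplexity.CLUS.muOf k ε C' N))`

## Assembly
Pure logic: `closes (h₁ : UniversalCertAll) (h₂ : PairModelReduction) (h₃ : PolylogGivesCapped) :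
ClusExistsCapped := h₃ (h₂ h₁)` — the conclusion is
the route's own TARGET decl (the rung leaf's definiens, token-identical to the companion's
`CLUSExistsCapped`; `Iff.rfl` checked), so the route is
born `draft` (glue.conclusion-mismatch vs `PneNP`) exactly as route-PneNP-Nc03AvoidResidualCore was;
once the operator registers
`Summit.PneNP.PneNP.Theses.ClusUniversalCertificate.ClusExistsCapped` as ALT-CLOSER rung F-N1
(D-0061), `ledger route edit <id> --closes-target <FQN>
--closes-file glue.lean` certifies it. Both cruxes are load-bearing (X1 open; X2 a genuine reduction
with two named open sub-steps); the support item
is provable now. The route closes the RUNG LEAF, not `PneNP`: the arrow CLUSExistsCapped ⇒ TR26-007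
Thm 4.3 is paper-math outside the cone (rung label).

CLOSES_TARGET: closes rung F-N1 of PneNP: Summit.PneNP.PneNP.Theses.ClusUniversalCertificate.ClusExistsCapped (D-0061; not the summit Statement) — the deciding theorem of this route concludes that registered leaf instead of the Statement decl `PneNP` (class rung: servable and labelled, never counted as concluding the summit Statement).

Rationale: WHY THIS LINE. Alekseev–Gaevoy (AlekseevGaevoy2026b, ECCC TR26-007) prove a size–depth tradeoff for
dag-like Res(⊕) on closure-based pigeonhole formulas
CBPHP conditional on their union-stability Conjecture 4.2 (= 1.4), which the tree REFUTES
(`Summit.PneNP.PneNP.Theorems.not_unionStabilityConjecture`,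
cube middle layer); their proof of Thm 4.3 (pp. 15–16) consumes the conjecture only for
CLOSURE-LOCAL deletions (from the nice set of a rank-≤ w
line delete the assignments violating an axiom inside the closure of line + queried form), and
`CLUSExistsCapped` substituted on p. 16 l. 1 yields
Thm 4.3 at one admissible point — a superpolynomial dag-like Res(⊕) size bound at depth N^(2+Ω(1)),
one rung past the printed quadratic wall
(EfremenkoGarlikItsykson2024, AlekseevItsykson2025, BhattacharyaEtAl2026: depth ≤ N^(2−ε)). The
mechanism is an ISOPERIMETRIC CERTIFICATE imported
from additive combinatorics / Boolean Fourier analysis on unions of affine flats: the kernel-proved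
trap lemma (a point is lost iff every member
containing it catches it inside its own piece closure) and the affine "blind-or-avoid" dichotomy (AG
Lemma 4.6, pairs) reduce amplification in the
pair model to LIFT, and sharp LiftCap (n−s)|Y| ≤ Σ_k 2^m|Y ∩ B_k| for unions of codim-≤ s flats
follows (kernel-proved in the cell file
Sketch-LiftCap.lean, `liftCapSharp_of_universal`) from the universal certificate R★★_b, whose
hypercube case m = 1 is PROVED (polynomial method over
𝔽₂: low-degree vanishing + odd-cover rank count; cell file UniversalCertificate.lean, 1001 lines,
farm rc 0) — nearest print: the k-DNF sensitivity
/ DNF-of-parities bounds (Jukna2012 Lemma 12.15; doi:10.1145/2840728.2840734) and the level-1 bound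
for parity decision trees (arXiv:1506.01055 Thm 1),
which lose √depth where R★★ charges the codimension of the LARGEST flat through each point and loses
nothing. No prior PneNP route states a
closure-local stability law or an affine-slice certificate (ReslinSizeFromWidth wants a formula-free
size–width law; negatives index: nothing on CLUS).

RANKED CRUXES. #0 ClusExistsCapped (target) — rung F-N1 leaf (CLUS∃-capped): some admissible point q
> 2, c ∈ (0,1], k ≥ 3, ε ∈ (0,1) with (k−1−ε)c > 2, and C, N₀, such that for all N ≥ N₀ SOME f with
properties (i),(ii) of TR26-007 §3.1 makes every family of at most g_N = 2^((log₂N)^(q/2)) rank-≤ w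
≤ w_N systems with one query each, each retaining all but a μ_N fraction of every closure piece,
lose at most a μ_N^c fraction of the nice union — verbatim the cell companion's `CLUSExistsCapped`
(to be registered as ALT-CLOSER rung F-N1, D-0061). (why it might fail: a closure-respecting
amplifier beyond the two known templates H/H′ (which reach loss ratio Θ(w) and provably no more)
with R ≥ N^(k−3−ε) for every f would kill it; AG's own Conj. 4.2 is already false (cube middle
layer).) [AlekseevGaevoy2026b, EfremenkoGarlikItsykson2024, BhattacharyaEtAl2026]
#2 UniversalCertAll (crux) — the universal block affine-slice certificate R★★_b for all n, m: for
every finite Y ⊆ (𝔽₂^m)^n, Σ_{y∈Y} (n − codim_Y(y)) ≤ Σ_{k<n} 2^m·#{y ∈ Y : y_k = 0}, where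
codim_Y(y) is the least c such that some affine subspace A ∋ y with A ⊆ Y has codimension ≤ c
(KEY-LEMMA.md §0; m = 1 proved, cell file UniversalCertificate.lean `universalCert_one`; exhaustive
for all block types of 𝔽₂⁴ and (𝔽₂²)², kit j246015; ~1.7·10⁵ adversarial sets, 0 failures).
[difficulty: L] (why it might fail: only m = 1 is proved; for m ≥ 2 a cross-block Sidon-type
configuration (the shape that killed the stronger KL★ at N = 9, |Y| = 148) could beat the block
count once n·m ≥ 9, beyond the exhaustive range.) [Jukna2012, arXiv:1506.01055,
doi:10.1145/2840728.2840734, AlekseevGaevoy2026b]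
#3 PairModelReduction (crux) — the certificate implies PolyLoss: from R★★_b (all n, m) — via sharp
LiftCap (kernel-proved consequence, `liftCapSharp_of_universal`), the trap lemma T (kernel-proved,
companion `not_lost_of_sat_of_not_collIn`), the affine pair dichotomy L1 = AG Lemma 4.6 and
avoidance capacity L2 (𝔽₂-Farkas, paper) — every closure-respecting family of rank-≤ w systems at k
≥ 4 has loss ratio R ≤ (w+1)² + O(w), i.e. `CLUSPolylog` (ROUND-2 §3, DAY4-LIFT §C of the cell
record); the two sub-steps not yet on paper are the watcher-relative weighted form Σ_j P[K_j]·lift_j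
≤ O(s)·P[U] and the (k+1)-tuple consensus step. [deps: UniversalCertAll] [difficulty: L] (why it
might fail: the watcher-relative weighting may lose a factor growing with the family size g_N rather
than with w, and tuple (not pair) violations at k ≥ 5 have no LiftCap analogue yet; either gap would
leave PolyLoss open even given the certificate.) [AlekseevGaevoy2026b, AlekseevItsykson2025,
EfremenkoItsykson2025]
#9 PolylogGivesCapped (support) — PolyLoss implies the capped door: `CLUSPolylog → CLUSExists →
CLUSExistsCapped` (choose c midway between 2/(k−1−ε) and 1; a polylog is eventually below
N^((k−1−ε)(1−c)); capping only weakens) — PROVED in the cell companion file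
ClosureLocalUnionStabilityTheorems.lean (`clusExists_of_polylog`, `exists_muOf_le_rpow`,
`clusExistsCapped_of_exists`, farm rc 0), to be landed under Theorems/ against this item.
[difficulty: provable-now] [AlekseevGaevoy2026b]

TWO-LAYER PLAN. UniversalCertAll ⇐ FibreExists → FibreLift → UniversalCertAll, where FibreExists
(FIB∃, ROUND-7 §V.6 of the cell literature seat) = "for every
block structure and nonempty Y some block k has slack(Y) ≥ Σ_v slack(Y_v) over the fibres Y_v = Y ∩
{y_k = v}" and FibreLift = the induction on n
through the identity slack(Y) = Σ_v slack(Y_v) + [G_k + SA_k − D_k]; alternative children (LI) local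
improvement, or the m-induction by block
peeling (KL♭ on optimal bases, KEY-LEMMA §8) whose m = 1 base is the proved `universalCert_one`.
PairModelReduction ⇐ WeightedLiftCap → TupleConsensus
→ PairModelReduction (the two named open sub-steps). Nothing of this is filed now; skeleton stubs
carry it (bc/).

KILL CRITERIA. A finite Y ⊆ (𝔽₂^m)^n violating R★★_b (oracle: cell scripts pnp-ideate-lit/v7/fib.py,
restrict_lp.py; ILP/SA campaigns) refutes UniversalCertAll and
closes the route `refuted:UniversalCertAll` unless the violation has m·n beyond the door's regime
and a restricted certificate (unions of ≤ g flats of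
codim ≤ s) survives — then pivot to `LiftCapSharp` as the crux (FlatFamily form, cell
Sketch-LiftCap.lean). A closure-respecting family with loss ratio
R growing faster than every polynomial in w refutes CLUSPolylog and with it PairModelReduction's
target: pivot to the c-form CLUSExists directly or close.
A refutation of the leaf itself (R ≥ N^(k−3−ε−o(1)) for every f) closes the route and the rung. An
unconditional dag-like Res(⊕) bound at depth
N^(2+Ω(1)) in print moots it (`superseded`).

NOT DECOMPOSED YET. The m ≥ 2 induction scheme for R★★_b ((FIB∃)/(LI)/block peeling — three
candidate splits, none chosen), the weighted LiftCap and tuple-consensus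
sub-steps of PairModelReduction, the constants (C′ = C + O(1) expected; q, k = 4 vs k ≥ 5), and the
paper-math substitution arrow into TR26-007
Thm 4.3 (outside the cone by the rung label) are layer-2 material, filed only after a crux closes or
a skeleton registers them.

CHEAPEST FALSIFIER. Exhaustive / ILP search for a violator of R★★_b on the smallest untested block
types ((2,2,1), (3,2), (2,2,2): n·m = 5–6) with the cell oracle
(pnp-ideate-lit/v7/fib.py, restrict_lp.py JOB_LIFT=1) — one kit job; done so far: all subsets of
𝔽₂³, 𝔽₂⁴ in every block type and (𝔽₂²)² (kit
j246015), 1.7·10⁵ adversarial sets n·m ≤ 7, the Sidon families N = 9, 10 (margins 50, 38): 0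
violations. Next cheapest: the m = 1 Lean proof
(UniversalCertificate.lean, rc 0) landing against UniversalCertAll's BC5 rung — a failure to port
would expose a junk-value mismatch in codim_Y.

NUMBERS. Depth wall for dag-like Res(⊕) size bounds in print: N² (EfremenkoGarlikItsykson2024 BPHP;
AlekseevItsykson2025 lifting; BhattacharyaEtAl2026
N^(2−ε)); target depth N^(2+Ω(1)) at size 2^((log N)^(q/2)), q > 2 (AlekseevGaevoy2026b Thm 4.3 with
Conj. 4.2 replaced). Amplification measured
in the cell: templates H/H′ reach loss ratio R = Θ(w) and provably no more (L2); every template run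
has λ ≤ w²/M; kit j241561 (21 cells, 10⁶
samples: max R_avg 1.000, max R_max 0.663), j242113. Certificate evidence: R★★ (m = 1) PROVED all n;
R★★_b exhaustive on 𝔽₂³, 𝔽₂⁴ (all block
types), (𝔽₂²)²; KL★ (a stronger form) FALSE at N = 9 (|Y| = 148, bias 132 > 128) while R★★ holds
there with margin 50.

DEFINITION REQUESTS. Vocabulary is in tree:
Literature/Computability/MetaComplexity/ClosureLocalUnionStability.lean (p404966; item
defn-ClosureLocalUnionStable). Wanted
landings by a PROVER (planner cannot write Theorems/): (i)
HOME/pnp-ideate-lit/ClosureLocalUnionStabilityTheorems.lean (companion: CLUSExistsCapped,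
CLUSPolylog, clusExists_of_polylog …) `--supports` PolylogGivesCapped; (ii)
HOME/pnp-ideate-lit/UniversalCertificate.lean (`universalCert_one`, m = 1)
`--supports` UniversalCertAll (BC5 rung); then ALT-CLOSER registration of
`Summit.PneNP.PneNP.Theses.ClusUniversalCertificate.ClusExistsCapped` = rung F-N1.

Novelty: Searches (2026-08-25/26; cell record KEY-LEMMA §6, ROUND-2 §6, this seat): lit search --hybrid
"union of affine subspaces over F2 coordinate slices codimension inequality" (8 textbook hits, none
relevant); lit vsearch of the certificate in prose (0 docs); lit galaxy search "union of affine
subspaces|DNF of parities|parity decision tree" --star all (20 rows, no statement); earlier cell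
null queries (corpus fts+vec + galaxy): "level-1 Fourier coefficients union of affine subspaces",
"mean weight of a union of codim-≤s affine subspaces", galaxy "resolution over
parities|Res(⊕)|parity decision DAG". First-hand reads: AlekseevGaevoy2026b (paper:url-9096d7ef0edf:
Conj 4.2 p0059, Thm 4.3 p0096, proof p0105–0112), ECCC TR25-160 (paper:url-6739f8dccf4d pp. 1, 3,
12), Jukna2012 p.361 Lemma 12.15, arXiv:1506.01055 Thm 1 / Lemma 3.1, doi:10.1145/2840728.2840734
p.2.
Nearest prior art found: AlekseevGaevoy2026b (unrestricted Conj. 1.4/4.2 — false — and conditional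
Thm 4.3); arXiv:1506.01055 (Blais–Tan–Wan: ℓ¹ level-1 bound for parity decision trees, √depth loss,
DISJOINT leaves); Jukna2012 Lemma 12.15 (Boppana k-DNF sensitivity, hypercube ancestor of LiftCap).
Delta: nobody in print states the closure-local stability law, its c-free PolyLoss form, or an
affine-slice certificate charging the codimension of the largest flat through each point (lossless,
overlapping flats); its m = 1 case is proved here by a polynomial-method argument.
Claimed grade: new-combination  [refs: 10.1145/2840728.2840734, 1506.01055, paper:url-9096d7ef0edf, paper:url-6739f8dccf4d, doi:10.1145/2840728.2840734, AlekseevGaevoy2026b, Jukna2012]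

Barriers (technique_class: affine-slice-certificate, closure-restriction): - technique_class: affine-slice-certificate, closure-restriction
- Literature.Barriers.PneNP.NaturalProofs: not engaged — a lower bound for one proof system
(dag-like Res(⊕)) on one explicit formula family; no largeness/constructivity property is used.
- Literature.Barriers.PneNP.Relativization: not engaged — no machine simulation; a combinatorial
statement about affine flats over 𝔽₂.
- Literature.Barriers.PneNP.Algebrization: not engaged — same reason.
- Literature.Barriers.PneNP.FeasibleInterpolationEF: outside its class — CBPHP is not a split
(interpolant-shaped) formula; the argument is a restriction/closure game, not interpolation; Res(⊕)
is below the systems it quantifies over.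
- Ladder R-C5 ceiling (Literature/Barriers/PneNP/Ladder.lean §2, not a barrier decl): closure /
restart-walk arguments stop at depth N² (EfremenkoGarlikItsykson2024, AlekseevItsykson2025,
BhattacharyaEtAl2026); the route's bet is the ceiling-lifting input itself — a union-stability law
for closure-LOCAL deletions (target ClusExistsCapped, cruxes X1/X2), which AG isolate as the missing
ingredient; the refuted GLOBAL form (not_unionStabilityConjecture) is evaded: closure-local
deletions are blind-or-avoid (trap lemma T + L1), the cube-middle-layer witness is not.
- Negatives index: 6 refuted PneNP statements at filing (WindowBarrier, LyapunovRefutations,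
BavardGap, Circuit2, ORIncompressibility, TwoTones) — none concerns Res(⊕), CLUS or affine slices.

History (route lifecycle, newest last):
- 2026-08-26T16:47:08Z · closes_target -> closes rung F-N1 of PneNP: Summit.PneNP.PneNP.Theses.ClusUniversalCertificate.ClusExistsCapped (D-0061; not the summit Statement) (operator:999:2372973)
- 2026-09-05T02:34:43Z · DORMANT — reconciler: no traction for 5 d (last activity item-evidence-added at 2026-08-31T01:45:16Z); parked, not closed — `ledger route dormant route-PneNP-ClusUniversa (operator:999:2605846)

sub-problem: PneNP · status: dormant · opened planner-pnp-ideate-p1-g3-0 2026-08-26T16:24:02Z · rev 3 · ledger route-PneNP-ClusUniversalCertificate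
GENERATED by the gate from the ledger (D-0016/17). Provers cite these decls: `theorem foo : Summit.PneNP.PneNP.Theses.ClusUniversalCertificate.<Decl> := …` in Summits/PneNP/PneNP/Theorems/<Name>.lean.
-/

namespace Summit.PneNP.PneNP.Theses.ClusUniversalCertificate

open scoped BigOperators Topology Manifold Classical MeasureTheory ProbabilityTheory Matrix InnerProductSpace ComplexConjugate ContinuousMap
open Filter Set Function TopologicalSpace MeasureTheory

attribute [summit_statement] _root_.PneNP
-- H21.Audit: the closer leaf Summit.PneNP.PneNP.Theses.ClusUniversalCertificate.ClusExistsCapped is an item decl of this route file — tagged summit_statement below, after its declaration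

open Literature.PNP

/-- item stmt-PneNP-19682 · target · rank 0 · open · by planner
why it might fail: a closure-respecting amplifier beyond the two known templates H/H′ (which reach loss ratio Θ(w) and provably no more) with R ≥ N^(k−3−ε) for every f would kill it; AG's own Conj. 4.2 is already false (cube middle layer).
sources: AlekseevGaevoy2026b, EfremenkoGarlikItsykson2024, BhattacharyaEtAl2026
[target] rung F-N1 leaf (CLUS∃-capped): some admissible point q > 2, c ∈ (0,1], k ≥ 3, ε ∈ (0,1)
with (k−1−ε)c > 2, and C, N₀, such that for all N ≥ N₀ SOME f with properties (i),(ii) of TR26-007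
§3.1 makes every family of at most g_N = 2^((log₂N)^(q/2)) rank-≤ w ≤ w_N systems with one query
each, each retaining all but a μ_N fraction of every closure piece, lose at most a μ_N^c fraction of
the nice union — verbatim the cell companion's `CLUSExistsCapped` (to be registered as ALT-CLOSER
rung F-N1, D-0061). -/
@[route_item "route-PneNP-ClusUniversalCertificate"]
def ClusExistsCapped : Prop :=
  ∃ q : ℝ, 2 < q ∧ ∃ c : ℝ, 0 < c ∧ c ≤ 1 ∧ ∃ k : ℕ, 3 ≤ k ∧ ∃ ε : ℝ, 0 < ε ∧ ε < 1 ∧ 2 < ((k : ℝ) - 1 - ε) * c ∧ ∃ C : ℝ, ∃ N₀ : ℕ, ∀ N : ℕ, N₀ ≤ N → ∃ f : (Fin k → Literature.Computability.MetaComplexity.CLUS.Hole (Literature.Computability.MetaComplexity.CLUS.mOf k ε N)) → Literature.Computability.MetaComplexity.CLUS.Hole (Literature.Computability.MetaComplexity.CLUS.mOf k ε N), Literature.Computability.MetaComplexity.CLUS.PropI N (Literature.Computability.MetaComplexity.CLUS.mOf k ε N) k f ∧ Literature.Computability.MetaComplexity.CLUS.PropII (Literature.Computability.MetaComplexity.CLUS.mOf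 k ε N) k f ∧ ∀ w : ℕ, (w : ℝ) ≤ Literature.Computability.MetaComplexity.CLUS.wOf q N → Literature.Computability.MetaComplexity.CLUS.ClosureLocalUnionStableCapped N (Literature.Computability.MetaComplexity.CLUS.mOf k ε N) k f w (Literature.Computability.MetaComplexity.CLUS.gOf q N) (Literature.Computability.MetaComplexity.CLUS.muOf k ε C N) ((Literature.Computability.MetaComplexity.CLUS.muOf k ε C N) ^ c)

/-- item stmt-PneNP-19683 · crux · rank 2 · open · by planner
why it might fail: only m = 1 is proved; for m ≥ 2 a cross-block Sidon-type configuration (the shape that killed the stronger KL★ at N = 9, |Y| = 148) could beat the block count once n·m ≥ 9, beyond the exhaustive range.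
sources: Jukna2012, arXiv:1506.01055, doi:10.1145/2840728.2840734, AlekseevGaevoy2026b
[crux] the universal block affine-slice certificate R★★_b for all n, m: for every finite Y ⊆
(𝔽₂^m)^n, Σ_{y∈Y} (n − codim_Y(y)) ≤ Σ_{k<n} 2^m·#{y ∈ Y : y_k = 0}, where codim_Y(y) is the least c
such that some affine subspace A ∋ y with A ⊆ Y has codimension ≤ c (KEY-LEMMA.md §0; m = 1 proved,
cell file UniversalCertificate.lean `universalCert_one`; exhaustive for all block types of 𝔽₂⁴ and
(𝔽₂²)², kit j246015; ~1.7·10⁵ adversarial sets, 0 failures). [difficulty: L] -/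
@[route_item "route-PneNP-ClusUniversalCertificate"]
def UniversalCertAll : Prop :=
  ∀ n m : ℕ, ∀ Y : Finset (Fin n → Fin m → ZMod 2), ∑ y ∈ Y, ((n : ℤ) - ((sInf {c : ℕ | ∃ A : AffineSubspace (ZMod 2) (Fin n → Fin m → ZMod 2), y ∈ A ∧ (∀ z ∈ A, z ∈ Y) ∧ n * m ≤ Module.finrank (ZMod 2) A.direction + c} : ℕ) : ℤ)) ≤ ∑ k : Fin n, (2 : ℤ) ^ m * ((Y.filter fun y => y k = 0).card : ℤ)

/-- item stmt-PneNP-19684 · crux · rank 3 · open · by planner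
why it might fail: the watcher-relative weighting may lose a factor growing with the family size g_N rather than with w, and tuple (not pair) violations at k ≥ 5 have no LiftCap analogue yet; either gap would leave PolyLoss open even given the certificate.
sources: AlekseevGaevoy2026b, AlekseevItsykson2025, EfremenkoItsykson2025
[crux] the certificate implies PolyLoss: from R★★_b (all n, m) — via sharp LiftCap (kernel-proved
consequence, `liftCapSharp_of_universal`), the trap lemma T (kernel-proved, companion
`not_lost_of_sat_of_not_collIn`), the affine pair dichotomy L1 = AG Lemma 4.6 and avoidance capacity
L2 (𝔽₂-Farkas, paper) — every closure-respecting family of rank-≤ w systems at k ≥ 4 has loss ratio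
R ≤ (w+1)² + O(w), i.e. `CLUSPolylog` (ROUND-2 §3, DAY4-LIFT §C of the cell record); the two
sub-steps not yet on paper are the watcher-relative weighted form Σ_j P[K_j]·lift_j ≤ O(s)·P[U] and
the (k+1)-tuple consensus step. [deps: UniversalCertAll] [difficulty: L] -/
@[route_item "route-PneNP-ClusUniversalCertificate"]
def PairModelReduction : Prop :=
  UniversalCertAll → ∃ q : ℝ, 2 < q ∧ ∃ k : ℕ, 4 ≤ k ∧ ∃ ε : ℝ, 0 < ε ∧ ε < 1 ∧ ∃ C C' : ℝ, ∃ N₀ : ℕ, ∀ N : ℕ, N₀ ≤ N → ∃ f : (Fin k → Literature.Computability.MetaComplexity.CLUS.Hole (Literature.Computability.MetaComplexity.CLUS.mOf k ε N)) → Literature.Computability.MetaComplexity.CLUS.Hole (Literature.Computability.MetaComplexity.CLUS.mOf k ε N), Literature.Computability.MetaComplexity.CLUS.PropI N (Literature.Computability.MetaComplexity.CLUS.mOf k ε N) k f ∧ Literature.Computability.MetaComplexity.CLUS.PropII (Literature.Computability.MetaComplexity.CLUS.mOf k ε N) k f ∧ ∀ w : ℕ, (w : ℝ) ≤ Literature.Computability.MetaComplexity.CLUS.wOf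 q N → Literature.Computability.MetaComplexity.CLUS.ClosureLocalUnionStableAt N (Literature.Computability.MetaComplexity.CLUS.mOf k ε N) k f w (Literature.Computability.MetaComplexity.CLUS.muOf k ε C N) (Literature.Computability.MetaComplexity.CLUS.muOf k ε C' N)

/-- item stmt-PneNP-19685 · support · rank 9 · closed · proved by Summit.PneNP.PneNP.Theorems.ClusUniversalCertificatePolylogGivesCapped.polylogGivesCapped_holds (prover) · by planner
sources: AlekseevGaevoy2026b
[support] PolyLoss implies the capped door: `CLUSPolylog → CLUSExists → CLUSExistsCapped` (choose c
midway between 2/(k−1−ε) and 1; a polylog is eventually below N^((k−1−ε)(1−c)); capping only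
weakens) — PROVED in the cell companion file ClosureLocalUnionStabilityTheorems.lean
(`clusExists_of_polylog`, `exists_muOf_le_rpow`, `clusExistsCapped_of_exists`, farm rc 0), to be
landed under Theorems/ against this item. [difficulty: provable-now] -/
@[route_item "route-PneNP-ClusUniversalCertificate"]
def PolylogGivesCapped : Prop :=
  (∃ q : ℝ, 2 < q ∧ ∃ k : ℕ, 4 ≤ k ∧ ∃ ε : ℝ, 0 < ε ∧ ε < 1 ∧ ∃ C C' : ℝ, ∃ N₀ : ℕ, ∀ N : ℕ, N₀ ≤ N → ∃ f : (Fin k → Literature.Computability.MetaComplexity.CLUS.Hole (Literature.Computability.MetaComplexity.CLUS.mOf k ε N)) → Literature.Computability.MetaComplexity.CLUS.Hole (Literature.Computability.MetaComplexity.CLUS.mOf k ε N), Literature.Computability.MetaComplexity.CLUS.PropI N (Literature.Computability.MetaComplexity.CLUS.mOf k ε N) k f ∧ Literature.Computability.MetaComplexity.CLUS.PropII (Literature.Computability.MetaComplexity.CLUS.mOf k ε N) k f ∧ ∀ w : ℕ, (w : ℝ) ≤ Literature.Computability.MetaComplexity.CLUS.wOf q N → Literature.Computability.MetaComplexity.CLUS.ClosureLocalUnionStableAt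 N (Literature.Computability.MetaComplexity.CLUS.mOf k ε N) k f w (Literature.Computability.MetaComplexity.CLUS.muOf k ε C N) (Literature.Computability.MetaComplexity.CLUS.muOf k ε C' N)) → ClusExistsCapped

-- `PolylogGivesCapped` holds: proved by `Summit.PneNP.PneNP.Theorems.ClusUniversalCertificatePolylogGivesCapped.polylogGivesCapped_holds` (its module imports this route file, so no `_holds` link can be stated here).

/-- item stmt-PneNP-19686 · assembly · rank 1 · closed · proved by Summit.PneNP.PneNP.Theorems.clusUniversalCertificate_assembly_proof (prover) · by planner
sources: AlekseevGaevoy2026b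
[assembly] UniversalCertAll → PairModelReduction → the rung leaf ClusExistsCapped (PolyLoss ⇒ capped
door being the proved support step). -/
@[route_item "route-PneNP-ClusUniversalCertificate"]
def Assembly : Prop :=
  UniversalCertAll → PairModelReduction → ClusExistsCapped

-- `Assembly` holds: proved by `Summit.PneNP.PneNP.Theorems.clusUniversalCertificate_assembly_proof` (its module imports this route file, so no `_holds` link can be stated here).

attribute [summit_statement] _root_.Summit.PneNP.PneNP.Theses.ClusUniversalCertificate.ClusExistsCapped

/-! D-0027 §2.1 — DECIDING THEOREM (planner-authored via `route open/edit --closes-file`; by operator:999:2372973 2026-08-26T16:47:08Z):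
its hypotheses are this route's items and its conclusion the registered leaf `Summit.PneNP.PneNP.Theses.ClusUniversalCertificate.ClusExistsCapped` (rung F-N1, D-0061) (glue_lint), and it elaborates with this file. -/

@[closes "route-PneNP-ClusUniversalCertificate"] theorem closes (h₁ : UniversalCertAll) (h₂ : PairModelReduction) (h₃ : PolylogGivesCapped) :
    ClusExistsCapped := h₃ (h₂ h₁)

end Summit.PneNP.PneNP.Theses.ClusUniversalCertificate
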